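import Summits.NavierStokesRegularity.NavierStokesRegularity.Theorems.PerpetualPumpAveragedTypeIBlowupSynthFieldModes

/-!
# Crux `PerpetualPump.AveragedTypeIBlowup` (stmt-NavierStokesRegularity-1835), line `Sketch`:
# stub `synthField` — the wavelet Duhamel series of a chain solution is an `H¹⁰_df`-continuous field

T. Tao, *Finite time blowup for an averaged three-dimensional Navier–Stokes equation*, J. Amer.
Math. Soc. **29** (2016), 601–674 = arXiv:1402.0290v3, §4 p. 22, (4.14): a mild solution of the
cascade equation (3.3)/(4.1) is the wavelet Duhamel series
`u(t) = e^{tΔ}u₀ + Σ_{i,n} ∫₀ᵗ G_{i,n}(s) e^{(t-s)Δ} ψ_{i,n} ds`, `G_{i,n} = quadTerm(X)_{i,n}`.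

The registered stub `stub_synthField` of the line's skeleton runs this backwards: given a
continuous solution `Y` of the exact coefficient chain on `[0,S)` from the datum `A ψ_{i₀,n₀}`,
vanishing below the scale `n₀` and decaying super-polynomially in the scale on compact
sub-intervals (`(1+ε₀)^{20n}|Y_{i,n}| ≤ C` on `[0,S']`), the series *defines* a field
`u : [0,S) → H¹⁰_df(ℝ³)`, continuous in `H¹⁰`, whose pairings are the convergent series of the
pairings of its terms. Construction (over the tools file
`PerpetualPumpAveragedTypeIBlowupSynthFieldTools.lean` and the modes file
`PerpetualPumpAveragedTypeIBlowupSynthFieldModes.lean`):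

* the drive `quadTerm(Y)_{i,n}` vanishes for `n ≤ n₀ - 2` and is `O(C² (1+ε₀)^{(75/2)(1-n)})` on
  `[0,S']` (`abs_quadTerm_le`), so the Duhamel term `D_{i,n}(t) = ∫₀ᵗ quadTerm(Y)_{i,n}(s) e^{(t-s)Δ}ψ_{i,n} ds`
  (band-limited to the region of the mode, real, divergence free) has, after the band weight
  `W_{i,n} = (1_{R_{i,n}}(1+|ξ|²)⁵)(D)` of size `(1+ρ_n²)⁵`, `ρ_n = (1+ε₀)ⁿ(1+ε₀/2)`, a norm dominated
  by a summable shifted geometric family (`exists_summable_bound`, ratio `(1+ε₀)^{-55/2}`);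
* hence `G(t) = Σ_{i,n} W_{i,n} D_{i,n}(t)` converges absolutely in `L²`, locally uniformly on
  `[0,S)` (so `G` is `L²`-continuous, each term being a continuous band Duhamel element), and
  `u(t) = e^{tΔ}(A ψ_{i₀,n₀}) + J G(t)`, `J = (1+|D|²)^{-5}`, has `u(t) - e^{tΔ}u₀ = Σ D_{i,n}(t)` in
  `L²`, `‖J G(t)‖_{H¹⁰} ≤ ‖G(t)‖_{L²}`, `‖u(t) - u(t₀)‖_{H¹⁰} ≤ c‖e^{tΔ}u₀ - e^{t₀Δ}u₀‖ + ‖G(t) - G(t₀)‖`.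

Nothing here closes the item (`--supports`); no statement of the route changes.

## References

* T. Tao, J. Amer. Math. Soc. 29 (2016), 601–674, arXiv:1402.0290v3, §4 p. 22 (4.14), (4.8).
  [`Tao2016AveragedNS`]
-/

noncomputable section

-- the summit namespace `…NavierStokesRegularity.NavierStokesRegularity…` is the tree convention
set_option linter.dupNamespace false

open MeasureTheory Set Filter Topology
open scoped ENNReal
open scoped InnerProductSpace
open Literature.Analysis
open Literature.Analysis.FluidPDE Literature.Analysis.FluidPDE.Tao2016
open Literature.Analysis.FluidPDE.TaoCascade (quadTerm IsSymmetricCoeff IsCancellingCoeff shiftSet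
  mem_shiftSet_iff)
open Summit.NavierStokesRegularity.NavierStokesRegularity.Theorems.PerpetualPumpEulerTypeIGlue
  (norm_heat_le continuous_heat_apply)

namespace Summit.NavierStokesRegularity.NavierStokesRegularity.Theorems.PerpetualPumpAveragedTypeIBlowup

variable {ε₀ : ℝ} {m : ℕ}

/-! ### Assembly of the field `u(t) = e^{tΔ}u₀ + J G(t)` -/

section Assembly

variable (hε : 0 < 1 + ε₀) (𝒟 : CascadeWaveletData ε₀ m) {u₀ : L2C} {i₀ : Fin m} {n₀ : ℤ}
  (hu₀ : MemH10df u₀) (hu₀b : IsBandLimited (freqRegion 𝒟 i₀ n₀) u₀)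
  {S : ℝ} {D : Fin m × ℤ → ℝ → L2C} {G : ℝ → L2C}
  (hDb : ∀ p, ∀ t ∈ Ico 0 S, IsBandLimited (freqRegion 𝒟 p.1 p.2) (D p t))
  (hDr : ∀ p, ∀ t ∈ Ico 0 S, IsReal (D p t))
  (hDd : ∀ p, ∀ t ∈ Ico 0 S, IsFourierDivFree (D p t))
  (hG : ∀ t ∈ Ico 0 S, HasSum (fun p : Fin m × ℤ => fourierMultiplier ((memLp_bandWeightFn
    (measurableSet_freqRegion 𝒟 p.1 p.2) (freqRegion_subset_closedBall hε 𝒟 p.1 p.2)).toLp _) (D p t)) (G t))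
  (hGc : ∀ S' : ℝ, S' < S → ContinuousOn G (Icc 0 S'))

include hDb hG in
/-- **The Duhamel series converges in `L²`**: `Σ_p D_p(t) = J G(t)` for `t ∈ [0,S)` (apply `J` to the
weighted series; `J W_{R_p} D_p = D_p`). [cite: Tao2016AveragedNS, §4 p. 22 (4.14)] -/
theorem hasSum_modes {t : ℝ} (ht : t ∈ Ico 0 S) :
    HasSum (fun p : Fin m × ℤ => D p t) (fourierMultiplier (memLp_besselInvFn.toLp _) (G t)) :=
  hasSum_of_hasSum_bandWeight (ι := Fin m × ℤ) (R := fun p => freqRegion 𝒟 p.1 p.2)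
    (fun p => measurableSet_freqRegion 𝒟 p.1 p.2) (ρ := fun p => (1 + ε₀) ^ p.2 * (1 + ε₀ / 2))
    (fun p => freqRegion_subset_closedBall hε 𝒟 p.1 p.2) (fun p => hDb p t ht) (hG t ht)

include hu₀ hDb hDr hDd hG in
/-- **The field is `H¹⁰_df`-valued**: `u(t) = e^{tΔ}u₀ + J G(t) ∈ H¹⁰_df` for `t ∈ [0,S)` —
`e^{tΔ}` preserves `H¹⁰_df`, `‖J G‖_{H¹⁰} ≤ ‖G‖_{L²}`, and `J G(t) = Σ D_p(t)` is a sum of real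
divergence-free fields. [cite: Tao2016AveragedNS, §4 p. 22 (4.14)] -/
theorem memH10df_synth {t : ℝ} (ht : t ∈ Ico 0 S) :
    MemH10df (heat t u₀ + fourierMultiplier (memLp_besselInvFn.toLp _) (G t)) := by
  have hV := hasSum_modes hε 𝒟 hDb hG ht
  refine (hu₀.heat t).add ⟨?_, ?_, ?_⟩
  · exact (eFourierSobolevNorm_besselInv_le _).trans_lt enorm_lt_top
  · exact isReal_of_hasSum (fun p => hDr p t ht) hV
  · exact isFourierDivFree_of_hasSum (fun p => hDd p t ht) hV

include hDb hG in
/-- **The pairings of the field**: `⟨u(t), w⟩ - ⟨e^{tΔ}u₀, w⟩ = Σ_p ⟨D_p(t), w⟩` for `t ∈ [0,S)` and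
every `w ∈ L²`. [cite: Tao2016AveragedNS, §4 p. 22 (4.14)] -/
theorem hasSum_pairing_synth {t : ℝ} (ht : t ∈ Ico 0 S) (w : L2C) :
    HasSum (fun p : Fin m × ℤ => pairing (D p t) w)
      (pairing (heat t u₀ + fourierMultiplier (memLp_besselInvFn.toLp _) (G t)) w -
        pairing (heat t u₀) w) := by
  rw [pairing_add_left, add_sub_cancel_left]
  exact hasSum_pairing_left (hasSum_modes hε 𝒟 hDb hG ht) w

include hε hu₀b hGc in
/-- **The field is `H¹⁰`-continuous on `[0,S)`**: near `t₀ < S' < S`,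
`‖u(t) - u(t₀)‖_{H¹⁰} ≤ (1+ρ₀²)⁵ ‖e^{tΔ}u₀ - e^{t₀Δ}u₀‖_{L²} + ‖G(t) - G(t₀)‖_{L²} → 0`
(`u₀` band-limited, `e^{tΔ}` strongly continuous, `G` continuous on `[0,S']`). [cite: Tao2016AveragedNS, §4 p. 22 (4.14)] -/
theorem continuousInH10On_synth :
    ContinuousInH10On (Ico 0 S) (fun t => heat t u₀ + fourierMultiplier (memLp_besselInvFn.toLp _) (G t)) := by
  intro t₀ ht₀
  set S' : ℝ := (t₀ + S) / 2 with hS'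
  have hS'1 : t₀ < S' := by rw [hS']; linarith [ht₀.2]
  have hS'2 : S' < S := by rw [hS']; linarith [ht₀.2]
  have ht₀' : t₀ ∈ Icc 0 S' := ⟨ht₀.1, hS'1.le⟩
  have hρ₀ := freqRegion_subset_closedBall hε 𝒟 i₀ n₀
  -- the `H¹⁰` distance is controlled by two `L²` distances
  have hbound : ∀ t, FunctionSpaces.eFourierSobolevNorm 10
      ((heat t u₀ + fourierMultiplier (memLp_besselInvFn.toLp _) (G t)) -
        (heat t₀ u₀ + fourierMultiplier (memLp_besselInvFn.toLp _) (G t₀))) ≤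
      ENNReal.ofReal ((1 + ((1 + ε₀) ^ n₀ * (1 + ε₀ / 2)) ^ 2) ^ ((10 : ℝ) / 2)) *
          ‖heat t u₀ - heat t₀ u₀‖ₑ + ‖G t - G t₀‖ₑ := fun t =>
    (eFourierSobolevNorm_add_besselInv_sub_le _ _ _ _).trans (add_le_add
      (IsBandLimited.eFourierSobolevNorm_le (s := 10) hρ₀
        ((heat_isBandLimited hu₀b t).sub (heat_isBandLimited hu₀b t₀)) (by norm_num)) le_rfl)
  -- both tend to zero
  have h1 : Tendsto (fun t => ‖heat t u₀ - heat t₀ u₀‖ₑ) (𝓝 t₀) (𝓝 0) := by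
    have hc : Tendsto (fun t => heat t u₀ - heat t₀ u₀) (𝓝 t₀) (𝓝 (heat t₀ u₀ - heat t₀ u₀)) :=
      ((continuous_heat_apply u₀).tendsto t₀).sub tendsto_const_nhds
    rw [sub_self] at hc
    simpa using hc.enorm
  have h2 : Tendsto (fun t => ‖G t - G t₀‖ₑ) (𝓝[Icc 0 S'] t₀) (𝓝 0) := by
    have hc : Tendsto (fun t => G t - G t₀) (𝓝[Icc 0 S'] t₀) (𝓝 (G t₀ - G t₀)) :=
      ((hGc S' hS'2) t₀ ht₀').tendsto.sub tendsto_const_nhds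
    rw [sub_self] at hc
    simpa using hc.enorm
  have h3 : Tendsto (fun t => ENNReal.ofReal ((1 + ((1 + ε₀) ^ n₀ * (1 + ε₀ / 2)) ^ 2) ^ ((10 : ℝ) / 2)) *
      ‖heat t u₀ - heat t₀ u₀‖ₑ + ‖G t - G t₀‖ₑ) (𝓝[Icc 0 S'] t₀) (𝓝 0) := by
    have h := (ENNReal.Tendsto.const_mul
      (a := ENNReal.ofReal ((1 + ((1 + ε₀) ^ n₀ * (1 + ε₀ / 2)) ^ 2) ^ ((10 : ℝ) / 2)))
      (h1.mono_left nhdsWithin_le_nhds) (Or.inr ENNReal.ofReal_ne_top)).add h2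
    simpa using h
  have h4 : Tendsto (fun t => FunctionSpaces.eFourierSobolevNorm 10
      ((heat t u₀ + fourierMultiplier (memLp_besselInvFn.toLp _) (G t)) -
        (heat t₀ u₀ + fourierMultiplier (memLp_besselInvFn.toLp _) (G t₀))))
      (𝓝[Icc 0 S'] t₀) (𝓝 0) :=
    tendsto_of_tendsto_of_tendsto_of_le_of_le tendsto_const_nhds h3 (fun _ => zero_le) hbound
  -- `[0,S')`-neighbourhoods of `t₀` inside `[0,S)` are `[0,S']`-neighbourhoods
  have hle : 𝓝[Ico 0 S] t₀ ≤ 𝓝[Icc 0 S'] t₀ :=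
    nhdsWithin_le_iff.2 (mem_of_superset (inter_mem_nhdsWithin (Ico 0 S) (Iio_mem_nhds hS'1))
      fun t ht => ⟨ht.1.1, le_of_lt ht.2⟩)
  exact h4.mono_left hle

end Assembly

/-! ### The registered stub -/

/-- **Stub `synthField` (line `Sketch` of crux `AveragedTypeIBlowup`).** Given a continuous solution
`Y` of the exact Volterra chain on `[0,S)` from the datum `A ψ_{i₀,n₀}` (no modes below `n₀`,
super-polynomial decay in the scale on compact sub-intervals), the wavelet Duhamel series
`u(t) = e^{tΔ}(Aψ_{i₀,n₀}) + Σ_{i,n} ∫₀ᵗ quadTerm(Y)_{i,n}(s) e^{(t-s)Δ}ψ_{i,n} ds` defines an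
`H¹⁰_df`-valued, `H¹⁰`-continuous field on `[0,S)` (recorded through its pairings, as a convergent
series). The field is `u(t) = e^{tΔ}u₀ + J Σ_{i,n} W_{i,n} D_{i,n}(t)` with the Duhamel terms
`D_{i,n}(t)` (`exists_summable_bound`: summable domination, locally uniform in `t`),
`J = (1+|D|²)^{-5}`, `W_{i,n} = (1_{R_{i,n}}(1+|ξ|²)⁵)(D)`; the chain identity itself is not needed. [cite: Tao2016AveragedNS, §4 p. 22 (4.14)] -/
theorem stub_synthField :
    ∀ {ε₀ : ℝ}, 0 < ε₀ → ε₀ ≤ 1 → ∀ {m : ℕ} (𝒟 : CascadeWaveletData ε₀ m)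
      (α : Fin m → Fin m → Fin m → ℤ × ℤ × ℤ → ℝ) (i₀ : Fin m) (n₀ : ℤ) (A S : ℝ)
      (Y : Fin m → ℤ → ℝ → ℝ), 0 < S →
      (∀ i n, ContinuousOn (Y i n) (Ico 0 S)) →
      (∀ i n t, n < n₀ → Y i n t = 0) →
      (∀ S' : ℝ, S' < S → ∃ C : ℝ, ∀ (i : Fin m) (n : ℤ), ∀ t ∈ Icc 0 S',
        (1 + ε₀) ^ ((20 : ℝ) * n) * |Y i n t| ≤ C) →
      (∀ (i : Fin m) (n : ℤ), ∀ t ∈ Ico 0 S,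
        Y i n t = (if i = i₀ ∧ n = n₀ then A else 0) *
            (pairing (heat t (cascadeWavelet ε₀ (𝒟.ψ i) n)) (cascadeWavelet ε₀ (𝒟.ψ i) n)).re +
          ∫ s in (0 : ℝ)..t,
            (pairing (heat (t - s) (cascadeWavelet ε₀ (𝒟.ψ i) n)) (cascadeWavelet ε₀ (𝒟.ψ i) n)).re *
              quadTerm ε₀ α Y i n s) →
      ∃ u : ℝ → L2C, (∀ t ∈ Ico 0 S, MemH10df (u t)) ∧ ContinuousInH10On (Ico 0 S) u ∧
        ∀ t ∈ Ico 0 S, ∀ w : L2C,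
          HasSum (fun p : Fin m × ℤ => ∫ s in (0 : ℝ)..t,
              (quadTerm ε₀ α Y p.1 p.2 s : ℂ) * pairing (heat (t - s) (cascadeWavelet ε₀ (𝒟.ψ p.1) p.2)) w)
            (pairing (u t) w - pairing (heat t ((A : ℂ) • cascadeWavelet ε₀ (𝒟.ψ i₀) n₀)) w) := by
  intro ε₀ hε₀ _ m 𝒟 α i₀ n₀ A S Y _ hcont hlow hdec _
  have hε : 0 < 1 + ε₀ := by linarith
  -- the datum
  have hu₀ : MemH10df ((A : ℂ) • cascadeWavelet ε₀ (𝒟.ψ i₀) n₀) :=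
    (𝒟.memH10df_cascadeWavelet hε i₀ n₀).smul A
  have hu₀b : IsBandLimited (freqRegion 𝒟 i₀ n₀) ((A : ℂ) • cascadeWavelet ε₀ (𝒟.ψ i₀) n₀) :=
    (cascadeWavelet_isBandLimited hε 𝒟 i₀ n₀).smul _
  -- the Duhamel terms `D_p(t)` and the weighted sum `G(t)`
  set D : Fin m × ℤ → ℝ → L2C := fun p t => ∫ s in (0 : ℝ)..t,
    ((quadTerm ε₀ α Y p.1 p.2 s : ℝ) : ℂ) • heat (t - s) (cascadeWavelet ε₀ (𝒟.ψ p.1) p.2) with hD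
  set G : ℝ → L2C := fun t => ∑' p : Fin m × ℤ, fourierMultiplier ((memLp_bandWeightFn
    (measurableSet_freqRegion 𝒟 p.1 p.2) (freqRegion_subset_closedBall hε 𝒟 p.1 p.2)).toLp _) (D p t)
    with hG
  -- the integrands are interval integrable on `[0,t] ⊆ [0,S)`
  have hint : ∀ (p : Fin m × ℤ), ∀ t ∈ Ico 0 S, IntervalIntegrable (fun s =>
      ((quadTerm ε₀ α Y p.1 p.2 s : ℝ) : ℂ) • heat (t - s) (cascadeWavelet ε₀ (𝒟.ψ p.1) p.2)) volume 0 t :=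
    fun p t ht => intervalIntegrable_smul_heat ht.1 (Complex.continuous_ofReal.comp_continuousOn
      ((continuousOn_quadTerm α hcont p.1 p.2).mono (Icc_subset_Ico_right ht.2))) _
  have hDb : ∀ p, ∀ t ∈ Ico 0 S, IsBandLimited (freqRegion 𝒟 p.1 p.2) (D p t) := fun p t ht =>
    isBandLimited_intervalIntegral_smul_heat 𝒟 p.1 p.2 (cascadeWavelet_isBandLimited hε 𝒟 p.1 p.2)
      (hint p t ht)
  have hDr : ∀ p, ∀ t ∈ Ico 0 S, IsReal (D p t) := fun p t ht =>
    isReal_intervalIntegral_smul_heat (isReal_cascadeWavelet ε₀ (𝒟.ψ p.1) p.2) (hint p t ht)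
  have hDd : ∀ p, ∀ t ∈ Ico 0 S, IsFourierDivFree (D p t) := fun p t ht =>
    isFourierDivFree_intervalIntegral_smul_heat (𝒟.isFourierDivFree_cascadeWavelet hε p.1 p.2) (hint p t ht)
  -- absolute convergence of the weighted series, pointwise and locally uniformly
  have hGs : ∀ t ∈ Ico 0 S, HasSum (fun p : Fin m × ℤ => fourierMultiplier ((memLp_bandWeightFn
      (measurableSet_freqRegion 𝒟 p.1 p.2) (freqRegion_subset_closedBall hε 𝒟 p.1 p.2)).toLp _) (D p t))
      (G t) := fun t ht => by
    obtain ⟨M, hM, hb⟩ := exists_summable_bound hε₀ hε 𝒟 α hlow hdec ht.2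
    exact (Summable.of_norm_bounded hM fun p => hb p t ⟨ht.1, le_rfl⟩).hasSum
  have hGc : ∀ S' : ℝ, S' < S → ContinuousOn G (Icc 0 S') := by
    intro S' hS'
    rcases lt_or_ge S' 0 with hneg | hS'0
    · rw [Icc_eq_empty_of_lt hneg]
      exact continuousOn_empty _
    obtain ⟨M, hM, hb⟩ := exists_summable_bound hε₀ hε 𝒟 α hlow hdec hS'
    have hIcc : Icc 0 S' ⊆ Ico 0 S := Icc_subset_Ico_right hS'
    have hclamp : ∀ s : ℝ, max 0 (min s S') ∈ Icc (0 : ℝ) S' := fun s =>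
      ⟨le_max_left _ _, max_le hS'0 (min_le_right _ _)⟩
    have hDc : ∀ p : Fin m × ℤ, ContinuousOn (D p) (Icc 0 S') := fun p => by
      have hg : Continuous fun s : ℝ => ((quadTerm ε₀ α Y p.1 p.2 (max 0 (min s S')) : ℝ) : ℂ) :=
        Complex.continuous_ofReal.comp (((continuousOn_quadTerm α hcont p.1 p.2).mono hIcc).comp_continuous
          (continuous_const.max (continuous_id.min continuous_const)) hclamp)
      refine continuousOn_intervalIntegral_smul_heat hε 𝒟 p.1 p.2 (cascadeWavelet_isBandLimited hε 𝒟 p.1 p.2)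
        hg (q := fun s => ((quadTerm ε₀ α Y p.1 p.2 s : ℝ) : ℂ)) fun s hs => ?_
      simp only [min_eq_left hs.2, max_eq_right hs.1]
    exact continuousOn_tsum (fun p => (continuous_fourierMultiplier _).comp_continuousOn (hDc p)) hM
      fun p t ht => hb p t ht
  -- the field
  refine ⟨fun t => heat t ((A : ℂ) • cascadeWavelet ε₀ (𝒟.ψ i₀) n₀) +
      fourierMultiplier (memLp_besselInvFn.toLp _) (G t),
    fun t ht => memH10df_synth hε 𝒟 hu₀ hDb hDr hDd hGs ht,
    continuousInH10On_synth hε 𝒟 hu₀b hGc, fun t ht w => ?_⟩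
  have h := hasSum_pairing_synth hε 𝒟 hDb hGs ht w (u₀ := (A : ℂ) • cascadeWavelet ε₀ (𝒟.ψ i₀) n₀)
  have hfun : (fun p : Fin m × ℤ => pairing (D p t) w) = fun p : Fin m × ℤ => ∫ s in (0 : ℝ)..t,
      (quadTerm ε₀ α Y p.1 p.2 s : ℂ) * pairing (heat (t - s) (cascadeWavelet ε₀ (𝒟.ψ p.1) p.2)) w :=
    funext fun p => pairing_intervalIntegral_smul (hint p t ht) w
  rw [hfun] at h
  exact h

end Summit.NavierStokesRegularity.NavierStokesRegularity.Theorems.PerpetualPumpAveragedTypeIBlowup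

end
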